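import Mathlib
import HarnessLib
import Summits.NavierStokesRegularity.NavierStokesRegularity.Theses.PoloidalWindowDoor
import Literature.Analysis.FluidPDE.LocalTypeI
import Literature.Analysis.FluidPDE.LiouvilleExcludesLocalTypeI
import Summits.NavierStokesRegularity.NavierStokesRegularity.Theorems.PoloidalWindowDoorPoloidalWindowRigidityWindow
import Summits.NavierStokesRegularity.NavierStokesRegularity.Theorems.PoloidalWindowDoorLocalPointZoomSlices
import Summits.NavierStokesRegularity.NavierStokesRegularity.Theorems.AxisTwistDoorTiltDominationLocEnergyClass

/-!
# Route `PoloidalWindowDoor`: a NON-ZERO profile of the Type-I class IS a witness of Albritton–Barker's second bullet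
# (`NontrivialMildAncientTypeIExists`), so the crux `PoloidalWindowRigidity` (stmt-19708), item `LrcModEntire`
# (stmt-20428) and the rung leaf `Target` all sit BELOW «no local Type-I singularity» — ladder placement, closes nothing

Seat ns-poloidal-K2-p2 g10 (LEAD-lineage on 19708; file `--supports`).  Let `v` be a profile of the route's Type-I
ancient mild class (rate `‖v(t,x)‖ ≤ C/√(−t)`, continuity on the open backward slab, unit-viscosity Oseen identity,
divergence-free slices) with `v(s₀,x₀) ≠ 0` for some `s₀ < 0`.  The time shift `w(t) = v(t − δ)`, `δ = −s₀/2`,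
is again in the class (`IsTypeIAncientMild.comp_sub_right`), is a BOUNDED ancient mild solution
(`IsTypeIAncientMild.isBoundedAncientMildSolution_sub`), belongs to the energy class with `𝐈(ℝ³ × ℝ₋) < ∞`
(ns-atd-p1's `…AxisTwistDoorTiltDominationLocEnergyClass.exists_energyClass_of_typeI`, built on the K2 a-priori package
`scaledEnergy` / `scaledCubic` / `scaledPressure_threeHalves`), and is not a.e. zero on the slab (continuity,
`Measure.eqOn_open_of_ae_eq`).  Hence:

* `nontrivialMildAncientTypeIExists_of_class_ne_zero` — a non-zero class profile witnesses
  `Literature.Analysis.FluidPDE.NontrivialMildAncientTypeIExists` (A–B 2019, Thm 1.1, second bullet; registered OPEN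
  statement, equivalent to the first bullet `LocalTypeISingularityExists` by the tree theorem
  `AlbrittonBarkerTypeICharacterization_holds`);
* `class_eq_zero_of_not_localTypeISingularityExists` — if suitable weak solutions have NO local Type-I singular point
  (A–B's printed sense), the class is `{0}`;
* `poloidalWindowRigidity_of_not_localTypeISingularityExists`, `lrcModEntire_of_not_localTypeISingularityExists`,
  `target_of_not_localTypeISingularityExists` — 19708, 20428 and the rung leaf N0-LocalTubeDoorPoloidal follow from
  `¬ LocalTypeISingularityExists`; with `LiouvilleExcludesLocalTypeI.not_localTypeISingularityExists_of_liouvilleConjectureNS`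
  this refines the (L)-placement of `…PoloidalWindowDoorOfLiouville`.

So the honest logical position of the crux is: 19708 ⇐ «no Type-I singularity» ⇐ (L); conversely a counterexample to
19708 would be (a poloidal) Type-I blow-up profile.  WHAT THIS IS NOT: not a proof of 19708/20428, not a statement about
Navier–Stokes regularity (Clay A OPEN; both A–B bullets OPEN). [cite: AlbrittonBarker2019, Thm 1.1 and §1; KochNadirashviliSereginSverak2009, §1]
-/

noncomputable section

-- the summit and its single sub-problem share the name (CONVENTIONS §1), as in every Theorems file
set_option linter.dupNamespace false

namespace Summit.NavierStokesRegularity.NavierStokesRegularity.Theorems.PoloidalWindowDoorOfNoLocalTypeI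

open MeasureTheory Set Function Filter Topology
open scoped RealInnerProductSpace InnerProductSpace ENNReal
open Literature.Analysis Literature.Analysis.FluidPDE
open Summit.NavierStokesRegularity.NavierStokesRegularity.Theses.PoloidalWindowDoor (PoloidalWindowRigidity LrcModEntire Target)
open Summit.NavierStokesRegularity.NavierStokesRegularity.Theorems.PoloidalWindowDoorPoloidalWindowRigidityWindow
  (isTypeIAncientMild_of_class)
open Summit.NavierStokesRegularity.NavierStokesRegularity.Theorems.AxisTwistDoorTiltDominationLocEnergyClass
  (exists_energyClass_of_typeI)

variable {C : ℝ} {v : ℝ → EuclideanSpace ℝ (Fin 3) → EuclideanSpace ℝ (Fin 3)}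

/-- **A non-zero profile of the Type-I class witnesses Albritton–Barker's second bullet.**  If `v` is a Type-I ancient
Oseen-mild profile with `v(s₀, x₀) ≠ 0` for some `s₀ < 0`, then `w(t) = v(t + s₀/2)` is a non-trivial bounded ancient
mild solution with a slab pressure, a weak gradient and `𝐈(ℝ³ × ℝ₋) < ∞`, i.e. `NontrivialMildAncientTypeIExists`.
[cite: AlbrittonBarker2019, Thm 1.1 (second bullet) and §1] -/
theorem nontrivialMildAncientTypeIExists_of_class_ne_zero (hrate : HasTypeITimeDecay C v)
    (hcont : ContinuousOn (uncurry v) (Iio (0 : ℝ) ×ˢ univ))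
    (hmild : ∀ s t : ℝ, s < t → t < 0 → ∀ x,
      v t x = UnboundedOperators.heatExtension (v s) (t - s) x - oseenDuhamel 1 s v v t x)
    (hdiv : ∀ t < 0, VectorCalculus.IsDivFree (v t)) {s₀ : ℝ} (hs₀ : s₀ < 0) {x₀ : EuclideanSpace ℝ (Fin 3)}
    (hne : v s₀ x₀ ≠ 0) : NontrivialMildAncientTypeIExists := by
  have h : IsTypeIAncientMild C v := isTypeIAncientMild_of_class hrate hcont hmild hdiv
  set δ : ℝ := -s₀ / 2 with hδ
  have hδ0 : 0 < δ := by rw [hδ]; linarith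
  -- the shifted field: in the class, bounded, in the energy class
  set w : ℝ → EuclideanSpace ℝ (Fin 3) → EuclideanSpace ℝ (Fin 3) := fun s => v (s - δ) with hw
  have hwT : IsTypeIAncientMild C w := h.comp_sub_right hδ0.le
  have hwB : IsBoundedAncientMildSolution 1 w := h.isBoundedAncientMildSolution_sub hδ0
  obtain ⟨π, H, hsw, hH, hI⟩ := exists_energyClass_of_typeI hwT.2.2.2 hwT.continuousOn_uncurry
    (fun s t hst ht x => hwT.mild_eq_heatExtension hst ht x) hwT.2.1
  refine ⟨w, π, H, hwB, hsw, hH, fun hae => ?_, hI⟩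
  -- non-triviality: `w (s₀ + δ) x₀ = v s₀ x₀ ≠ 0`, and `w` is continuous on the open slab
  have hEq : EqOn (uncurry w) 0 (Iio (0 : ℝ) ×ˢ (univ : Set (EuclideanSpace ℝ (Fin 3)))) :=
    Measure.eqOn_open_of_ae_eq hae (isOpen_Iio.prod isOpen_univ) hwT.continuousOn_uncurry
      continuous_zero.continuousOn
  have hs : s₀ + δ < 0 := by rw [hδ]; linarith
  have h0 : w (s₀ + δ) x₀ = 0 := by
    have := hEq (mk_mem_prod (mem_Iio.2 hs) (mem_univ x₀))
    simpa only [uncurry_apply_pair, Pi.zero_apply] using this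
  have : v s₀ x₀ = 0 := by simpa only [hw, add_sub_cancel_right] using h0
  exact hne this

/-- **If there is no local Type-I singular point (A–B's printed sense), the Type-I class is `{0}`.**  By the tree theorem
`AlbrittonBarkerTypeICharacterization_holds` (A–B Thm 1.1) a non-zero profile would give a local Type-I singularity
(`nontrivialMildAncientTypeIExists_of_class_ne_zero`). [cite: AlbrittonBarker2019, Thm 1.1] -/
theorem class_eq_zero_of_not_localTypeISingularityExists (hN : ¬ LocalTypeISingularityExists)
    (hrate : HasTypeITimeDecay C v) (hcont : ContinuousOn (uncurry v) (Iio (0 : ℝ) ×ˢ univ))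
    (hmild : ∀ s t : ℝ, s < t → t < 0 → ∀ x,
      v t x = UnboundedOperators.heatExtension (v s) (t - s) x - oseenDuhamel 1 s v v t x)
    (hdiv : ∀ t < 0, VectorCalculus.IsDivFree (v t)) : ∀ t < 0, ∀ x, v t x = 0 := by
  intro t ht x
  by_contra hne
  exact hN (AlbrittonBarkerTypeICharacterization_holds.mpr
    (nontrivialMildAncientTypeIExists_of_class_ne_zero hrate hcont hmild hdiv ht hne))

/-- **The crux from a class-emptiness statement** (shared plumbing): if every profile of the class vanishes on `t < 0`,
`PoloidalWindowRigidity` holds — zero vorticity slices are continuous and a field vanishing on the unit past ball is not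
backward-singular at the apex; the poloidal window hypothesis is not used. [folklore] -/
theorem poloidalWindowRigidity_of_class_eq_zero
    (hZ : ∀ (C : ℝ) (v : ℝ → EuclideanSpace ℝ (Fin 3) → EuclideanSpace ℝ (Fin 3)), HasTypeITimeDecay C v →
      ContinuousOn (uncurry v) (Iio (0 : ℝ) ×ˢ univ) →
      (∀ s t : ℝ, s < t → t < 0 → ∀ x,
        v t x = UnboundedOperators.heatExtension (v s) (t - s) x - oseenDuhamel 1 s v v t x) →
      (∀ t < 0, VectorCalculus.IsDivFree (v t)) → ∀ t < 0, ∀ x, v t x = 0) :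
    PoloidalWindowRigidity := by
  intro C v hrate hcont hmild hdiv
  have hz : ∀ t < 0, ∀ x, v t x = 0 := hZ C v hrate hcont hmild hdiv
  refine ⟨fun s hs => ?_, fun _e _he _hwin hsing => ?_⟩
  · have hvs : v s = fun _ => 0 := funext (hz s hs)
    have hcurl : curl (v s) = fun _ => 0 := by
      funext y
      rw [hvs]
      ext i
      fin_cases i <;> simp [curl]
    rw [hcurl]
    exact continuous_const
  · have h1 := hsing 1 one_pos
    have hae : uncurry v =ᵐ[volume.restrict (parabolicCylinder 1 (0 : ℝ × EuclideanSpace ℝ (Fin 3)))] 0 := by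
      filter_upwards [ae_restrict_mem (isOpen_parabolicCylinder 1 (0 : ℝ × EuclideanSpace ℝ (Fin 3))).measurableSet]
        with z hz'
      rw [mem_parabolicCylinder] at hz'
      have ht : z.1 < 0 := by simpa using hz'.1.2
      simp [uncurry, hz z.1 ht z.2]
    rw [eLpNorm_congr_ae hae, eLpNorm_zero] at h1
    exact ENNReal.zero_ne_top h1

/-- **Item 20428 from a class-emptiness statement** (shared plumbing, vacuous case): for `v ≡ 0` no nonempty open set
of the backward slab carries the pin `curl v ≠ 0`. [folklore] -/
theorem lrcModEntire_of_class_eq_zero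
    (hZ : ∀ (C : ℝ) (v : ℝ → EuclideanSpace ℝ (Fin 3) → EuclideanSpace ℝ (Fin 3)), HasTypeITimeDecay C v →
      ContinuousOn (uncurry v) (Iio (0 : ℝ) ×ˢ univ) →
      (∀ s t : ℝ, s < t → t < 0 → ∀ x,
        v t x = UnboundedOperators.heatExtension (v s) (t - s) x - oseenDuhamel 1 s v v t x) →
      (∀ t < 0, VectorCalculus.IsDivFree (v t)) → ∀ t < 0, ∀ x, v t x = 0) :
    LrcModEntire := by
  intro C v hrate hcont hmild hdiv _hpol W _hW hWne hWsub hpins _hslope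
  obtain ⟨z, hz⟩ := hWne
  have hz1 : z.1 < 0 := (Set.mem_prod.1 (hWsub hz)).1
  have hvs : v z.1 = fun _ => 0 := funext (hZ C v hrate hcont hmild hdiv z.1 hz1)
  have hcurl : curl (v z.1) z.2 = 0 := by
    rw [hvs]
    ext i
    fin_cases i <;> simp [curl]
  exact absurd hcurl (hpins z hz).1

/-- **Crux 19708 `PoloidalWindowRigidity` below «no local Type-I singularity».** [cite: AlbrittonBarker2019, Thm 1.1] -/
theorem poloidalWindowRigidity_of_not_localTypeISingularityExists (hN : ¬ LocalTypeISingularityExists) :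
    PoloidalWindowRigidity :=
  poloidalWindowRigidity_of_class_eq_zero fun _C _v hrate hcont hmild hdiv =>
    class_eq_zero_of_not_localTypeISingularityExists hN hrate hcont hmild hdiv

/-- **Item 20428 `LrcModEntire` below «no local Type-I singularity»** (vacuously). [cite: AlbrittonBarker2019, Thm 1.1] -/
theorem lrcModEntire_of_not_localTypeISingularityExists (hN : ¬ LocalTypeISingularityExists) : LrcModEntire :=
  lrcModEntire_of_class_eq_zero fun _C _v hrate hcont hmild hdiv =>
    class_eq_zero_of_not_localTypeISingularityExists hN hrate hcont hmild hdiv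

/-- **The rung leaf `Target` (N0-LocalTubeDoorPoloidal) below «no local Type-I singularity»**: the route's deciding
theorem `closes` with the tree theorem K1 `localPointZoomSlices_proof`. [cite: AlbrittonBarker2019, Thm 1.1] -/
theorem target_of_not_localTypeISingularityExists (hN : ¬ LocalTypeISingularityExists) : Target :=
  Summit.NavierStokesRegularity.NavierStokesRegularity.Theses.PoloidalWindowDoor.closes
    Summit.NavierStokesRegularity.NavierStokesRegularity.Theorems.PoloidalWindowDoorLocalPointZoomSlices.localPointZoomSlices_proof
    (poloidalWindowRigidity_of_not_localTypeISingularityExists hN)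

/-- **The same below «no non-trivial mild bounded ancient solution with `𝐈 < ∞`»** (A–B's second bullet negated),
via `AlbrittonBarkerTypeICharacterization_holds`. [cite: AlbrittonBarker2019, Thm 1.1] -/
theorem poloidalWindowRigidity_of_not_nontrivialMildAncientTypeIExists (hN : ¬ NontrivialMildAncientTypeIExists) :
    PoloidalWindowRigidity :=
  poloidalWindowRigidity_of_not_localTypeISingularityExists fun h =>
    hN (AlbrittonBarkerTypeICharacterization_holds.mp h)

end Summit.NavierStokesRegularity.NavierStokesRegularity.Theorems.PoloidalWindowDoorOfNoLocalTypeI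

end
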